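import Literature.GroupTheory.CombinatorialGroupTheory.RandomSclFreeGroupFanTokens
import Literature.GroupTheory.CombinatorialGroupTheory.RandomSclFreeGroupFanCycle
import Literature.GroupTheory.CombinatorialGroupTheory.RandomSclFreeGroupFanCounts
import Literature.GroupTheory.CombinatorialGroupTheory.RandomSclFreeGroupTokenLinearize
import HarnessLib

/-!
# Random rigidity of scl (Calegari–Walker 2013): proofs, part 37 — the fan token structure of a
pairing, assembled and linearized

D. Calegari, A. Walker, *Random rigidity in the free group*, Geom. Topol. 17 (2013)
[CalegariWalker2013], §4.4. For an involution `π` of `Fin N` without fixed points such that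
`τ = π ∘ σ` has no fixed points and some big corner (e.g. a pairing of a cyclically reduced word,
`exists_big_corner`), and letters `Wl` with `Wl (π y) = (Wl y)⁻¹` read periodically in a word `vg`,
we produce the linearized token structure of the fan resolution of the fatgraph of `π` (parts
27–36): `Tn` tokens with starts, lengths and partners satisfying the axioms of
`token_comb_inequality` / `comb_event_of_good`, together with `∑ len = N`,
`Tn + 6·orb(τ) ≤ 3N`, the transport of sums over real tokens to big corners, and the bound
`≤ 3·#Bad` on tokens starting after a bad corner.

* **`exists_fan_token_structure`** — the packaged structure.
-/

noncomputable section

namespace Literature.GroupTheory.CombinatorialGroupTheory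

section FanStructure

open Equiv Finset

open scoped Classical

set_option maxHeartbeats 4000000 in
/-- **The fan token structure of a pairing (CW §4.4, "we artificially split open vertices of
higher valence so that `Y` is trivalent").** See the module docstring.
[cite: CalegariWalker2013, §4.4] -/
theorem exists_fan_token_structure {N : ℕ} (hN : 0 < N) (π : Equiv.Perm (Fin N))
    (hπ : ∀ y, π (π y) = y) (hτ : ∀ x, ((finRotate N).trans π) x ≠ x)
    (hex : ∃ x, ((finRotate N).trans π) (((finRotate N).trans π) x) ≠ x)
    (Bad : Finset (Fin N)) {A : Type*} (inv : A → A) (Wl : Fin N → A) (vg : ℕ → A) {n' off : ℕ}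
    (hNn : n' ∣ N) (hpair : ∀ y, Wl (π y) = inv (Wl y))
    (hWv : ∀ y : Fin N, Wl y = vg (off + (y : ℕ) % n')) :
    ∃ (g : Fin N → ℕ) (Tn : ℕ) (start len P : ℕ → ℕ),
      (∀ x, ((finRotate N).trans π) (((finRotate N).trans π) x) ≠ x →
        1 ≤ g x ∧ (∀ j, 1 ≤ j → j ≤ g x - 1 → ((finRotate N).trans π) (((finRotate N).trans π)
          (((finRotate N) ^ j) x)) = ((finRotate N) ^ j) x) ∧
        ((finRotate N).trans π) (((finRotate N).trans π) (((finRotate N) ^ (g x)) x)) ≠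
          ((finRotate N) ^ (g x)) x) ∧
      0 < Tn ∧
      (∀ p, p < Tn → start p < N) ∧
      (∀ p, p < Tn → start ((p + 1) % Tn) = (start p + len p) % N) ∧
      (∀ p, p < Tn → P p < Tn ∧ P (P p) = p) ∧
      (∀ p, p < Tn → len (P p) = len p) ∧
      (∀ p, p < Tn → P ((P p + 1) % Tn) = (P ((p + Tn - 1) % Tn) + Tn - 1) % Tn) ∧
      (∀ p, p < Tn → ∀ j, j < len p →
        vg (off + (start (P p) + j) % n') = inv (vg (off + (start p + (len p - 1 - j)) % n'))) ∧
      (∑ p ∈ Finset.range Tn, len p = N) ∧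
      (Tn + 6 * orbitCount ((finRotate N).trans π) ≤ 3 * N) ∧
      (∀ Q : ℕ → ℕ → ℕ, ∑ p ∈ Finset.range Tn, (if 0 < len p then Q (start p) (len p) else 0) =
        ∑ x ∈ (Finset.univ : Finset (Fin N)).filter
          (fun x => ((finRotate N).trans π) (((finRotate N).trans π) x) ≠ x),
          Q (((x : ℕ) + 1) % N) (g x)) ∧
      (((Finset.range Tn).filter fun p => ∃ x ∈ Bad, start p = ((x : ℕ) + 1) % N).card ≤
        3 * Bad.card) := by
  -- the gap function
  have hgap : ∀ x, ((finRotate N).trans π) (((finRotate N).trans π) x) ≠ x → ∃ gx, 1 ≤ gx ∧ gx ≤ N ∧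
      (∀ j, 1 ≤ j → j ≤ gx - 1 → ((finRotate N).trans π) (((finRotate N).trans π)
        (((finRotate N) ^ j) x)) = ((finRotate N) ^ j) x) ∧
      ((finRotate N).trans π) (((finRotate N).trans π) (((finRotate N) ^ gx) x)) ≠
        ((finRotate N) ^ gx) x := fun x hx => exists_gap hN _ x hx
  choose gf hgf1 hgfN hgfb hgfB using hgap
  set g : Fin N → ℕ := fun x =>
    if hx : ((finRotate N).trans π) (((finRotate N).trans π) x) ≠ x then gf x hx else 0 with hgdef
  have hg : ∀ x, ((finRotate N).trans π) (((finRotate N).trans π) x) ≠ x →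
      1 ≤ g x ∧ (∀ j, 1 ≤ j → j ≤ g x - 1 → ((finRotate N).trans π) (((finRotate N).trans π)
        (((finRotate N) ^ j) x)) = ((finRotate N) ^ j) x) ∧
      ((finRotate N).trans π) (((finRotate N).trans π) (((finRotate N) ^ (g x)) x)) ≠
        ((finRotate N) ^ (g x)) x := by
    intro x hx
    have e : g x = gf x hx := by simp only [hgdef]; rw [dif_pos hx]
    rw [e]
    exact ⟨hgf1 x hx, hgfb x hx, hgfB x hx⟩
  -- orbit data
  obtain ⟨apex, ind, rr, hrr3, hind, hper, hpow, hbad, -⟩ := exists_orbit_data _ hτ Bad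
  -- derived functions (opaque, with defining equations)
  obtain ⟨ff, hff⟩ : ∃ ff : Fin N → ℕ, ∀ x, ff x =
      if ind x = 0 then rr x - 3 else if 2 ≤ ind x ∧ ind x ≤ rr x - 2 then 1 else 0 := ⟨_, fun x => rfl⟩
  obtain ⟨nx, hnx⟩ : ∃ nx : Fin N → Fin N, ∀ x, nx x = ((finRotate N) ^ (g x)) x := ⟨_, fun x => rfl⟩
  obtain ⟨zc, hzc⟩ : ∃ zc : Fin N → Fin N, ∀ x,
      zc x = ((finRotate N).symm ^ (g x)) (((finRotate N).trans π) x) := ⟨_, fun x => rfl⟩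
  obtain ⟨pv, hpv⟩ : ∃ pv : Fin N → Fin N, ∀ x,
      pv x = ((finRotate N).symm ^ (g (((finRotate N).trans π).symm x)))
        (((finRotate N).trans π) (((finRotate N).trans π).symm x)) := ⟨_, fun x => rfl⟩
  obtain ⟨qc, hqc⟩ : ∃ qc : Fin N → ℕ → Fin N, ∀ x i,
      qc x i = (((finRotate N).trans π) ^ i) (apex x) := ⟨_, fun x i => rfl⟩
  obtain ⟨Sf, hSf⟩ : ∃ Sf : Fin N × ℕ → Fin N × ℕ, ∀ p,
      Sf p = if p.2 < ff p.1 then (p.1, p.2 + 1) else (nx p.1, 0) := ⟨_, fun p => rfl⟩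
  obtain ⟨Sb, hSb⟩ : ∃ Sb : Fin N × ℕ → Fin N × ℕ, ∀ p,
      Sb p = if 0 < p.2 then (p.1, p.2 - 1) else (pv p.1, ff (pv p.1)) := ⟨_, fun p => rfl⟩
  obtain ⟨Pf, hPf⟩ : ∃ Pf : Fin N × ℕ → Fin N × ℕ, ∀ p,
      Pf p = if p.2 = ff p.1 then (zc p.1, ff (zc p.1)) else
        if ind p.1 = 0 then (qc p.1 (rr p.1 - 2 - p.2), 0) else (apex p.1, rr p.1 - 2 - ind p.1) :=
    ⟨_, fun p => rfl⟩
  -- the pair-level structure theorems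
  have hSS := fun (p : Fin N × ℕ) hp => fan_Sb_Sf_Sb π hπ g hg ff nx pv hnx hpv Sf Sb hSf hSb (p := p) hp
  have hVS := fun (p : Fin N × ℕ) hp =>
    fan_valid_Sf_Sb π hπ g hg ff nx zc pv hnx hzc hpv Sf Sb hSf hSb (p := p) hp
  have hPP := fun (p : Fin N × ℕ) hp =>
    fan_Pf_Pf π hπ g hg apex ind rr hrr3 hind hper hpow ff hff nx zc pv hnx hzc hpv qc hqc Pf hPf (p := p) hp
  have hCO := fun (p : Fin N × ℕ) hp => fan_consecutive π g ff nx hnx Sf hSf hN (p := p) hp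
  have hWO := fun (p : Fin N × ℕ) hp =>
    fan_word π hπ g hg apex ind rr ff zc hzc qc Pf hPf hN inv Wl vg hNn hpair hWv (p := p) hp
  have hTR := fun (p : Fin N × ℕ) hp =>
    fan_trivalent π hπ g hg apex ind rr hrr3 hind hper hpow ff hff nx zc pv hnx hzc hpv qc hqc Sf Sb Pf
      hSf hSb hPf (p := p) hp
  -- slot bound
  have hffle : ∀ x, ((finRotate N).trans π) (((finRotate N).trans π) x) ≠ x → ff x + 3 ≤ rr x := by
    intro x hx
    have := hrr3 x hx
    have := (hind x hx).1
    rw [hff]; split_ifs <;> omega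
  have hslot : ∀ p : Fin N × ℕ, (((finRotate N).trans π) (((finRotate N).trans π) p.1) ≠ p.1 ∧
      p.2 ≤ ff p.1) → p.2 < N := by
    intro p hp
    have := hffle p.1 hp.1
    have := fan_orbit_size_le ((finRotate N).trans π) apex rr hper hp.1
    omega
  -- the token type
  let Valid : Fin N × Fin N → Prop := fun p =>
    ((finRotate N).trans π) (((finRotate N).trans π) p.1) ≠ p.1 ∧ (p.2 : ℕ) ≤ ff p.1
  let T := {p : Fin N × Fin N // Valid p}
  let toP : T → Fin N × ℕ := fun t => (t.1.1, (t.1.2 : ℕ))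
  have htoP : ∀ t : T, ((finRotate N).trans π) (((finRotate N).trans π) (toP t).1) ≠ (toP t).1 ∧
      (toP t).2 ≤ ff (toP t).1 := fun t => t.2
  have htoP_inj : ∀ t t' : T, toP t = toP t' → t = t' := by
    intro t t' h
    apply Subtype.ext
    have h1 := congrArg Prod.fst h
    have h2 := congrArg Prod.snd h
    exact Prod.ext h1 (Fin.ext h2)
  let ofP : ∀ p : Fin N × ℕ, (((finRotate N).trans π) (((finRotate N).trans π) p.1) ≠ p.1 ∧
      p.2 ≤ ff p.1) → T := fun p hp => ⟨(p.1, ⟨p.2, hslot p hp⟩), hp⟩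
  have htoP_ofP : ∀ p hp, toP (ofP p hp) = p := fun p hp => rfl
  -- successor, predecessor, partner on `T`
  let Sfun : T → T := fun t => ofP (Sf (toP t)) (hVS (toP t) (htoP t)).1
  let Sbfun : T → T := fun t => ofP (Sb (toP t)) (hVS (toP t) (htoP t)).2
  have hSfun : ∀ t, toP (Sfun t) = Sf (toP t) := fun t => rfl
  have hSbfun : ∀ t, toP (Sbfun t) = Sb (toP t) := fun t => rfl
  let S : Equiv.Perm T :=
    { toFun := Sfun
      invFun := Sbfun
      left_inv := fun t => htoP_inj _ _ (by rw [hSbfun, hSfun]; exact (hSS (toP t) (htoP t)).1)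
      right_inv := fun t => htoP_inj _ _ (by rw [hSfun, hSbfun]; exact (hSS (toP t) (htoP t)).2) }
  have hS_apply : ∀ t, toP (S t) = Sf (toP t) := fun t => rfl
  have hSsymm_apply : ∀ t, toP (S.symm t) = Sb (toP t) := fun t => rfl
  let PT : T → T := fun t => ofP (Pf (toP t)) (hPP (toP t) (htoP t)).1
  have hPT : ∀ t, toP (PT t) = Pf (toP t) := fun t => rfl
  let startT : T → ℕ := fun t => (((toP t).1 : ℕ) + 1) % N
  let lenT : T → ℕ := fun t => if (toP t).2 = ff (toP t).1 then g (toP t).1 else 0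
  -- the axioms on `T`
  have h1 : ∀ t, startT t < N := fun t => Nat.mod_lt _ hN
  have h2 : ∀ t, startT (S t) = (startT t + lenT t) % N := by
    intro t
    show ((((toP (S t)).1 : ℕ) + 1) % N) = _
    rw [hS_apply]
    exact hCO (toP t) (htoP t)
  have h3 : ∀ t, PT (PT t) = t := by
    intro t
    apply htoP_inj
    rw [hPT, hPT]
    exact (hPP (toP t) (htoP t)).2.1
  have h4 : ∀ t, lenT (PT t) = lenT t := by
    intro t
    show (if (toP (PT t)).2 = ff (toP (PT t)).1 then g (toP (PT t)).1 else 0) =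
      (if (toP t).2 = ff (toP t).1 then g (toP t).1 else 0)
    rw [hPT]
    exact (hPP (toP t) (htoP t)).2.2
  have h5 : ∀ t, PT (S (PT t)) = S.symm (PT (S.symm t)) := by
    intro t
    apply htoP_inj
    rw [hPT, hS_apply, hPT, hSsymm_apply, hPT, hSsymm_apply]
    exact hTR (toP t) (htoP t)
  have h6 : ∀ t j, j < lenT t → vg (off + (startT (PT t) + j) % n') =
      inv (vg (off + (startT t + (lenT t - 1 - j)) % n')) := by
    intro t j hj
    show vg (off + ((((toP (PT t)).1 : ℕ) + 1) % N + j) % n') =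
      inv (vg (off + ((((toP t).1 : ℕ) + 1) % N +
        ((if (toP t).2 = ff (toP t).1 then g (toP t).1 else 0) - 1 - j)) % n'))
    rw [hPT]
    exact hWO (toP t) (htoP t) j hj
  -- a token, and the single cycle
  obtain ⟨x₀, hx₀⟩ := hex
  let t₀ : T := ofP (x₀, 0) ⟨hx₀, Nat.zero_le _⟩
  have hiter : ∀ (k : ℕ) (t : T), toP ((S ^ k) t) = Sf^[k] (toP t) := by
    intro k
    induction k with
    | zero => intro t; simp
    | succ k ih =>
      intro t
      rw [pow_succ', Equiv.Perm.mul_apply, hS_apply, ih, Function.iterate_succ_apply']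
  have hSC : ∀ a b : T, S.SameCycle a b := by
    intro a b
    obtain ⟨k, hk⟩ := fan_reach π g hg hN ff nx hnx Sf hSf (htoP a) (htoP b)
    refine ⟨(k : ℤ), ?_⟩
    rw [zpow_natCast]
    apply htoP_inj
    rw [hiter, hk]
  have hS : S.IsCycleOn ((Finset.univ : Finset T) : Set T) := by
    rw [Finset.coe_univ]
    exact ⟨⟨Set.mapsTo_univ _ _, S.injective.injOn, fun y _ => ⟨S.symm y, Set.mem_univ _,
      S.apply_symm_apply y⟩⟩, fun a _ b _ => hSC a b⟩
  -- linearize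
  obtain ⟨start, len, P, e, H1, H2, H3, H4, H5, H6, H7, H8⟩ :=
    linearize_tokens S hS t₀ inv vg startT lenT PT h1 h2 h3 h4 h5 h6
  set Tn := Fintype.card T with hTn
  have hTnpos : 0 < Tn := Fintype.card_pos_iff.mpr ⟨t₀⟩
  -- the valid pairs as a finset, and `Tn`
  have hTcard : Tn = ((Finset.univ : Finset (Fin N × Fin N)).filter Valid).card := by
    rw [hTn]; exact Fintype.card_subtype _
  have hsumT : ∀ G : Fin N × Fin N → ℕ, ∑ t : T, G t.1 =
      ∑ p ∈ (Finset.univ : Finset (Fin N × Fin N)).filter Valid, G p := by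
    intro G
    rw [Finset.sum_subtype ((Finset.univ : Finset (Fin N × Fin N)).filter Valid) (p := Valid)
      (fun p => by simp)]
  refine ⟨g, Tn, start, len, P, hg, hTnpos, H1, H2, H3, H4, H5, H6, ?_, ?_, ?_, ?_⟩
  · -- `∑ len = N`
    have e1 : ∑ p ∈ Finset.range Tn, len p = ∑ p ∈ Finset.range Tn, lenT (e p) :=
      Finset.sum_congr rfl fun p hp => (H7 p (Finset.mem_range.mp hp)).2
    rw [e1]
    refine (H8 lenT).trans ?_
    have e2 := hsumT (fun p => if (p.2 : ℕ) = ff p.1 then g p.1 else 0)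
    rw [show (∑ t : T, lenT t) = ∑ t : T, (fun p : Fin N × Fin N =>
        if (p.2 : ℕ) = ff p.1 then g p.1 else 0) t.1 from rfl, e2,
      fan_sum_real_eq ((finRotate N).trans π) apex ind rr hrr3 hind hper ff hff g]
    exact sum_gap_eq π g hg hN ⟨x₀, hx₀⟩
  · -- `Tn + 6 orb ≤ 3N`
    rw [hTcard]
    exact fan_card_validPairs_add_six_mul_orbitCount_le ((finRotate N).trans π) apex ind rr hrr3
      hind hper hpow ff hff hτ
  · -- transport
    intro Q
    have e1 : ∑ p ∈ Finset.range Tn, (if 0 < len p then Q (start p) (len p) else 0) =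
        ∑ p ∈ Finset.range Tn, (fun t => if 0 < lenT t then Q (startT t) (lenT t) else 0) (e p) := by
      refine Finset.sum_congr rfl fun p hp => ?_
      obtain ⟨hs, hl⟩ := H7 p (Finset.mem_range.mp hp)
      simp only [hs, hl]
    rw [e1]
    refine (H8 (fun t => if 0 < lenT t then Q (startT t) (lenT t) else 0)).trans ?_
    have e2 := hsumT (fun p => if (p.2 : ℕ) = ff p.1 then Q (((p.1 : ℕ) + 1) % N) (g p.1) else 0)
    rw [← fan_sum_real_eq ((finRotate N).trans π) apex ind rr hrr3 hind hper ff hff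
      (fun x => Q (((x : ℕ) + 1) % N) (g x)), ← e2]
    refine Finset.sum_congr rfl fun t _ => ?_
    -- a token is real iff its length is positive
    show (if 0 < lenT t then Q (startT t) (lenT t) else 0) = _
    by_cases hr : ((t.1.2 : ℕ)) = ff t.1.1
    · have hl : lenT t = g t.1.1 := if_pos hr
      have hgpos : 0 < g t.1.1 := (hg _ t.2.1).1
      rw [hl, if_pos hgpos, if_pos hr]
    · have hl : lenT t = 0 := if_neg hr
      rw [hl, if_neg (lt_irrefl 0), if_neg hr]
  · -- bad starts
    have e1 : (((Finset.range Tn).filter fun p => ∃ x ∈ Bad, start p = ((x : ℕ) + 1) % N).card) =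
        ∑ p ∈ Finset.range Tn, (fun t => if ∃ x ∈ Bad, startT t = ((x : ℕ) + 1) % N then 1 else 0) (e p) := by
      rw [Finset.card_filter]
      refine Finset.sum_congr rfl fun p hp => ?_
      obtain ⟨hs, _⟩ := H7 p (Finset.mem_range.mp hp)
      simp only [hs]
    rw [e1]
    refine ((H8 (fun t => if ∃ x ∈ Bad, startT t = ((x : ℕ) + 1) % N then 1 else 0)).trans_le ?_)
    have e2 := hsumT (fun p => if ∃ x ∈ Bad, (((p.1 : ℕ) + 1) % N) = ((x : ℕ) + 1) % N then 1 else 0)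
    rw [show (∑ t : T, (if ∃ x ∈ Bad, startT t = ((x : ℕ) + 1) % N then 1 else 0)) =
      ∑ t : T, (fun p : Fin N × Fin N =>
        if ∃ x ∈ Bad, (((p.1 : ℕ) + 1) % N) = ((x : ℕ) + 1) % N then 1 else 0) t.1 from rfl, e2,
      ← Finset.card_filter]
    -- the start determines the corner
    have hsub : (((Finset.univ : Finset (Fin N × Fin N)).filter Valid).filter fun p =>
        ∃ x ∈ Bad, (((p.1 : ℕ) + 1) % N) = ((x : ℕ) + 1) % N) ⊆
        (Finset.univ : Finset (Fin N × Fin N)).filter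
          (fun p => (((finRotate N).trans π) (((finRotate N).trans π) p.1) ≠ p.1 ∧ p.1 ∈ Bad) ∧
            (p.2 : ℕ) ≤ ff p.1) := by
      intro p hp
      rw [Finset.mem_filter, Finset.mem_filter] at hp
      obtain ⟨⟨_, hv⟩, x, hxB, hpx⟩ := hp
      rw [Finset.mem_filter]
      refine ⟨Finset.mem_univ _, ⟨hv.1, ?_⟩, hv.2⟩
      have hpeq : p.1 = x := by
        apply Fin.ext
        have h1 := congrArg Fin.val (show (finRotate N) p.1 = (finRotate N) x from by
          apply Fin.ext; rw [val_finRotate hN, val_finRotate hN]; exact hpx)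
        exact congrArg Fin.val ((finRotate N).injective (Fin.ext h1))
      rw [hpeq]; exact hxB
    refine (Finset.card_le_card hsub).trans ?_
    exact fan_card_validPairs_bad_le ((finRotate N).trans π) apex ind rr hrr3 hind hper hpow ff hff
      Bad hbad

end FanStructure

end Literature.GroupTheory.CombinatorialGroupTheory

end
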